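import Literature.Probability.RandomPlanarGeometry.SAWFiniteMemoryKernelTrie
import Literature.Probability.RandomPlanarGeometry.SAWFiniteMemorySymm
import HarnessLib

/-!
# Kernel certificates for `μ(ℤ²)` on SYMMETRY-REDUCED tries (Pönitz–Tittmann "normalized states")

Topic `Literature/Probability/RandomPlanarGeometry` (continues `SAWFiniteMemoryKernelTrie.lean` and
`SAWFiniteMemorySymm.lean`). The trie certificates `verifyT` (kernel tier, `decide +kernel`) tabulate EVERY
state of the memory-`K` automaton `ptStep K` (`2885` states for `K = 10`, `15 225` for `K = 12`,
`≈ 8·10⁴` for `K = 14`); the symmetry-reduced check `checkC` of `SAWFiniteMemorySymm.lean` tabulates one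
state per orbit of the eight lattice symmetries (Pönitz–Tittmann §3: "we exploit this kind of symmetry by
normalizing states") but computes normal forms with `Finset.min'` and hash maps and is only ever run by
`native_decide`. This file is the KERNEL form of the reduced certificate:

* the table is a weight trie `WTrie` over ORBIT REPRESENTATIVES whose node payload `n = 4096·w + c` packs
  the weight `w = pw n` and, for each letter `d`, a symmetry number `pg n d ∈ {0,…,7}` (`symOf`: the four
  rotations and four reflections of the step alphabet, `syms`); the certificate thereby TELLS the verifier
  which symmetry carries the successor `ptStep K a d` onto a tabulated representative, so the kernel never
  computes a normal form — it applies one permutation of `Fin 4` to a word and looks it up;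
* `verifyStateS`, `verifyNodesS` (structural traversal), **`verifyTS K N D t`** — the Boolean check;
* soundness **`certificate_of_verifyTS`**: with the SYMMETRIC weight `symW t a` = the least positive tabulated
  weight on the orbit of `a` (invariant under `syms` by construction, so no uniqueness or normal-form check is
  needed), the equivariance `ptStep_map` transports the inequalities checked at a representative to its
  whole orbit: a `WordAutomaton.Certificate (ptStep K)` on `{a | 1 ≤ symW t a}` with `symW t [] ≤ 2⁴¹`;
* `count_mul_pow_le_of_verifyTS` (`cₙ Dⁿ ≤ Nⁿ 2⁴¹`), **`connectiveConstant_le_of_verifyTS`** (`μ(ℤ²) ≤ N/D`);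
* glue for split kernel evaluations (`verifyTS_of_children`, `verifyNodesS_of_children`, `WTrie.subtrie`)
  and the literal abbreviations `WTrie.Z/L/B` used by the data files (`SAWFiniteMemoryKernelSymmK….lean`).

The reduction is `≈ 8×` in states (`K = 12`: `1907` representatives; `K = 14`: `10 397`), which puts the
memory-12/14 bounds `2.7113` / `2.7014` of Pönitz–Tittmann's Table 2 within one or two kernel data files.

## References

* [PonitzTittmann2000] A. Pönitz, P. Tittmann, *Improved upper bounds for self-avoiding walks in ℤᵈ*,
  Electron. J. Combin. 7 (2000) R21, §2 (automaton), §3 (p. 6–7: normalizing states by the lattice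
  symmetries; eigenvalue bound), Table 2 (p. 9).
* L. Collatz, *Einschließungssatz für die charakteristischen Zahlen von Matrizen*, Math. Z. 48 (1942) 221–226.
-/

open Finset Filter Topology Literature.Probability.LatticeModels
open scoped BigOperators

namespace Literature.Probability.RandomPlanarGeometry.SAW

namespace FiniteMemory

/-! ### Literal abbreviations and sub-tries -/

namespace WTrie

/-- Abbreviation for data files: the empty sub-trie. [cite: PonitzTittmann2000, §3] -/
def Z : WTrie := WTrie.nil

/-- Abbreviation for data files: a leaf with payload `n`. [cite: PonitzTittmann2000, §3] -/
def L (n : ℕ) : WTrie := WTrie.node n Z Z Z Z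

/-- Abbreviation for data files: a branch node with payload `n`. [cite: PonitzTittmann2000, §3] -/
def B (n : ℕ) (c₀ c₁ c₂ c₃ : WTrie) : WTrie := WTrie.node n c₀ c₁ c₂ c₃

/-- The sub-trie below the word `a` (`nil` if absent); used to NAME the pieces of a split kernel
evaluation. [cite: PonitzTittmann2000, §3] -/
def subtrie : WTrie → List Step → WTrie
  | t, [] => t
  | nil, _ :: _ => nil
  | node _ c₀ c₁ c₂ c₃, d :: a => subtrie (child c₀ c₁ c₂ c₃ d) a

end WTrie

/-! ### Symmetry numbers and payload decoding -/

/-- The symmetry with number `i`: `0–3` the rotations `rot i`, `4–7` the reflections `refl (i-4)`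
(any `i ≥ 7` is `refl 3`). [cite: PonitzTittmann2000, §3] -/
def symOf : ℕ → (Step → Step)
  | 0 => rot 0
  | 1 => rot 1
  | 2 => rot 2
  | 3 => rot 3
  | 4 => refl 0
  | 5 => refl 1
  | 6 => refl 2
  | _ => refl 3

/-- Every `symOf i` is one of the eight lattice symmetries. [cite: PonitzTittmann2000, §3] -/
theorem symOf_mem_syms (i : ℕ) : symOf i ∈ syms := by
  unfold symOf syms
  rcases i with _ | _ | _ | _ | _ | _ | _ | _ <;> simp

/-- The weight part of a node payload `n = 4096·w + c`. [cite: PonitzTittmann2000, §3] -/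
def pw (n : ℕ) : ℕ := n / 4096

/-- The symmetry number for the letter `d` in a node payload (`3` bits per letter). [cite: PonitzTittmann2000, §3] -/
def pg (n : ℕ) (d : Step) : ℕ := n / 8 ^ (d : ℕ) % 8

/-! ### The verifier -/

/-- Check of one tabulated representative `a`: positive weight; for every letter `d` with a successor
`b = ptStep K a d`, the image of `b` under the recorded symmetry is tabulated with positive weight; and the
Collatz–Wielandt inequality `D · Σ_d w(image of successor) ≤ N · w(a)`. [cite: PonitzTittmann2000, §3] -/
def verifyStateS (K N D : ℕ) (t : WTrie) (a : List Step) : Bool :=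
  decide (1 ≤ pw (t.find a)) &&
    (List.finRange 4).all (fun d =>
      match ptStep K a d with
      | none => true
      | some b => decide (1 ≤ pw (t.find (b.map (symOf (pg (t.find a) d)))))) &&
    decide (D * ((List.finRange 4).map fun d =>
        ((ptStep K a d).map fun b => pw (t.find (b.map (symOf (pg (t.find a) d))))).getD 0).sum ≤
      N * pw (t.find a))

/-- Structural traversal of the trie: every node of positive weight, at the word `pre.reverse`, passes
`verifyStateS` against the whole trie `root`. [cite: PonitzTittmann2000, §3] -/
def verifyNodesS (K N D : ℕ) (root : WTrie) : WTrie → List Step → Bool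
  | WTrie.nil, _ => true
  | WTrie.node n c₀ c₁ c₂ c₃, pre =>
    (decide (pw n = 0) || verifyStateS K N D root pre.reverse) &&
      verifyNodesS K N D root c₀ ((0 : Step) :: pre) && verifyNodesS K N D root c₁ ((1 : Step) :: pre) &&
      verifyNodesS K N D root c₂ ((2 : Step) :: pre) && verifyNodesS K N D root c₃ ((3 : Step) :: pre)

/-- **The reduced trie certificate check**: root weight in `[1, 2⁴¹]` and every node of positive weight passes
`verifyStateS`. Evaluated by `decide +kernel` in the data files. [cite: PonitzTittmann2000, §3] -/
def verifyTS (K N D : ℕ) (t : WTrie) : Bool :=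
  decide (1 ≤ pw (t.find [])) && decide (pw (t.find []) ≤ 2 ^ 41) && verifyNodesS K N D t t []

/-! ### Glue for split kernel evaluations -/

/-- The traversal of an absent sub-trie succeeds. [cite: PonitzTittmann2000, §3] -/
@[simp] theorem verifyNodesS_nil (K N D : ℕ) (root : WTrie) (pre : List Step) :
    verifyNodesS K N D root WTrie.nil pre = true := rfl

/-- The traversal of `WTrie.Z` succeeds. [cite: PonitzTittmann2000, §3] -/
@[simp] theorem verifyNodesS_Z (K N D : ℕ) (root : WTrie) (pre : List Step) :
    verifyNodesS K N D root WTrie.Z pre = true := rfl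

/-- **Node glue**: a node passes the traversal if its own state check passes (or its weight is `0`) and its
four sub-tries pass (four separate kernel evaluations). [cite: PonitzTittmann2000, §3] -/
theorem verifyNodesS_of_children {K N D n : ℕ} {root c₀ c₁ c₂ c₃ : WTrie} {pre : List Step}
    (hs : (decide (pw n = 0) || verifyStateS K N D root pre.reverse) = true)
    (g₀ : verifyNodesS K N D root c₀ ((0 : Step) :: pre) = true)
    (g₁ : verifyNodesS K N D root c₁ ((1 : Step) :: pre) = true)
    (g₂ : verifyNodesS K N D root c₂ ((2 : Step) :: pre) = true)
    (g₃ : verifyNodesS K N D root c₃ ((3 : Step) :: pre) = true) :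
    verifyNodesS K N D root (WTrie.node n c₀ c₁ c₂ c₃) pre = true := by
  simp only [verifyNodesS, Bool.and_eq_true]
  exact ⟨⟨⟨⟨hs, g₀⟩, g₁⟩, g₂⟩, g₃⟩

/-- **Root glue**: if the root payload has weight in `[1, 2⁴¹]`, the root passes the state check, and each of
the four sub-tries passes the traversal, then `verifyTS` holds. [cite: PonitzTittmann2000, §3] -/
theorem verifyTS_of_children {K N D n : ℕ} {c₀ c₁ c₂ c₃ : WTrie} (h1 : 1 ≤ pw n) (h2 : pw n ≤ 2 ^ 41)
    (hr : verifyStateS K N D (WTrie.node n c₀ c₁ c₂ c₃) [] = true)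
    (g₀ : verifyNodesS K N D (WTrie.node n c₀ c₁ c₂ c₃) c₀ [(0 : Step)] = true)
    (g₁ : verifyNodesS K N D (WTrie.node n c₀ c₁ c₂ c₃) c₁ [(1 : Step)] = true)
    (g₂ : verifyNodesS K N D (WTrie.node n c₀ c₁ c₂ c₃) c₂ [(2 : Step)] = true)
    (g₃ : verifyNodesS K N D (WTrie.node n c₀ c₁ c₂ c₃) c₃ [(3 : Step)] = true) :
    verifyTS K N D (WTrie.node n c₀ c₁ c₂ c₃) = true := by
  have hw0 : ¬ pw n = 0 := by omega
  simp only [verifyTS, verifyNodesS, WTrie.find, List.reverse_nil, Bool.and_eq_true, Bool.or_eq_true,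
    decide_eq_true_eq]
  exact ⟨⟨h1, h2⟩, ⟨⟨⟨Or.inr hr, g₀⟩, g₁⟩, g₂⟩, g₃⟩

/-! ### Soundness of the traversal -/

/-- A word `pre.reverse ++ a` of positive weight in the sub-trie `t` passes the state check. [folklore] -/
private theorem verifyStateS_of_verifyNodesS {K N D : ℕ} {root : WTrie} :
    ∀ (t : WTrie) (pre a : List Step), verifyNodesS K N D root t pre = true → 1 ≤ pw (t.find a) →
      verifyStateS K N D root (pre.reverse ++ a) = true
  | WTrie.nil, pre, a, _, h => by simp [WTrie.find, pw] at h
  | WTrie.node n c₀ c₁ c₂ c₃, pre, [], hc, h => by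
    simp only [verifyNodesS, Bool.and_eq_true, Bool.or_eq_true, decide_eq_true_eq] at hc
    simp only [WTrie.find] at h
    rcases hc.1.1.1.1 with h0 | hv
    · omega
    · simpa using hv
  | WTrie.node n c₀ c₁ c₂ c₃, pre, d :: a, hc, h => by
    simp only [verifyNodesS, Bool.and_eq_true] at hc
    obtain ⟨⟨⟨⟨-, h0⟩, h1⟩, h2⟩, h3⟩ := hc
    have hfind : (WTrie.node n c₀ c₁ c₂ c₃).find (d :: a) = (WTrie.child c₀ c₁ c₂ c₃ d).find a := rfl
    rw [hfind] at h
    have key : ∀ (c : WTrie), verifyNodesS K N D root c (d :: pre) = true →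
        WTrie.find c a = WTrie.find (WTrie.child c₀ c₁ c₂ c₃ d) a →
        verifyStateS K N D root (pre.reverse ++ d :: a) = true := by
      intro c hcov he
      have := verifyStateS_of_verifyNodesS c (d :: pre) a hcov (by rw [he]; exact h)
      simpa using this
    fin_cases d
    · exact key c₀ h0 rfl
    · exact key c₁ h1 rfl
    · exact key c₂ h2 rfl
    · exact key c₃ h3 rfl

/-! ### Group facts about the eight symmetries (decided on `Fin 4`) -/

/-- Closure under composition (pointwise): `σ ∘ h` is a symmetry. [folklore] -/
private theorem syms_comp' : ∀ h ∈ syms, ∀ σ ∈ syms, ∃ k ∈ syms, ∀ d : Step, k d = σ (h d) := by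
  decide +kernel

/-- Right division (pointwise). [folklore] -/
private theorem syms_div' : ∀ g ∈ syms, ∀ k ∈ syms, ∃ h ∈ syms, ∀ d : Step, h (g d) = k d := by
  decide +kernel

/-- Inverses (pointwise, both sides). [folklore] -/
private theorem syms_inv' : ∀ g ∈ syms, ∃ g' ∈ syms, (∀ d : Step, g' (g d) = d) ∧ ∀ d : Step, g (g' d) = d := by
  decide +kernel

/-- Membership in the images. [folklore] -/
private theorem mem_images' {a b : List Step} : b ∈ images a ↔ ∃ g ∈ syms, b = a.map g := by
  simp only [images, List.mem_map, eq_comm]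

/-- The images of an image are the images (as a finset). [folklore] -/
private theorem images_toFinset_map' {g : Step → Step} (hg : g ∈ syms) (a : List Step) :
    (images (a.map g)).toFinset = (images a).toFinset := by
  ext b
  rw [List.mem_toFinset, List.mem_toFinset, mem_images', mem_images']
  constructor
  · rintro ⟨h, hh, rfl⟩
    obtain ⟨k, hk, hkd⟩ := syms_comp' g hg h hh
    exact ⟨k, hk, by rw [List.map_map]; exact List.map_congr_left fun d _ => (hkd d).symm⟩
  · rintro ⟨k, hk, rfl⟩
    obtain ⟨h, hh, hhd⟩ := syms_div' g hg k hk
    exact ⟨h, hh, by rw [List.map_map]; exact List.map_congr_left fun d _ => (hhd d).symm⟩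

/-! ### The symmetric weight -/

/-- The positive tabulated weights on the orbit of `a` under the eight symmetries. [cite: PonitzTittmann2000, §3] -/
def orbitW (t : WTrie) (a : List Step) : Finset ℕ :=
  ((images a).toFinset.image fun b => pw (t.find b)).filter fun w => 0 < w

/-- **The symmetric weight** read off a reduced table: the least positive tabulated weight on the orbit of `a`
(`0` if no image of `a` is tabulated). Never evaluated; it is the weight function of the soundness theorem.
[cite: PonitzTittmann2000, §3 ("states whose normalized representatives are the same … exhibit equal weights")] -/
def symW (t : WTrie) (a : List Step) : ℕ :=
  if h : (orbitW t a).Nonempty then (orbitW t a).min' h else 0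

/-- The orbit weights are invariant under the symmetries. [cite: PonitzTittmann2000, §3] -/
theorem orbitW_map (t : WTrie) {g : Step → Step} (hg : g ∈ syms) (a : List Step) :
    orbitW t (a.map g) = orbitW t a := by
  unfold orbitW
  rw [images_toFinset_map' hg]

/-- **The symmetric weight is invariant under the symmetries.** [cite: PonitzTittmann2000, §3] -/
theorem symW_map (t : WTrie) {g : Step → Step} (hg : g ∈ syms) (a : List Step) :
    symW t (a.map g) = symW t a := by
  unfold symW
  simp only [orbitW_map t hg]

/-- A positive tabulated weight of an image lies in the orbit weights. [cite: PonitzTittmann2000, §3] -/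
theorem mem_orbitW {t : WTrie} {g : Step → Step} (hg : g ∈ syms) {a : List Step}
    (h : 0 < pw (t.find (a.map g))) : pw (t.find (a.map g)) ∈ orbitW t a := by
  unfold orbitW
  rw [Finset.mem_filter, Finset.mem_image]
  exact ⟨⟨a.map g, List.mem_toFinset.2 (mem_images'.2 ⟨g, hg, rfl⟩), rfl⟩, h⟩

/-- The symmetric weight is at most every orbit weight. [cite: PonitzTittmann2000, §3] -/
theorem symW_le {t : WTrie} {a : List Step} {w : ℕ} (hw : w ∈ orbitW t a) : symW t a ≤ w := by
  unfold symW
  rw [dif_pos ⟨w, hw⟩]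
  exact Finset.min'_le _ _ hw

/-- The symmetric weight is positive as soon as some orbit weight is. [cite: PonitzTittmann2000, §3] -/
theorem symW_pos {t : WTrie} {a : List Step} {w : ℕ} (hw : w ∈ orbitW t a) : 0 < symW t a := by
  unfold symW
  rw [dif_pos ⟨w, hw⟩]
  have hm := Finset.min'_mem (orbitW t a) ⟨w, hw⟩
  unfold orbitW at hm
  exact (Finset.mem_filter.1 hm).2

/-- A positive symmetric weight is attained on the orbit: some image of `a` is tabulated with exactly that
weight. [cite: PonitzTittmann2000, §3] -/
theorem exists_map_eq_symW {t : WTrie} {a : List Step} (h : 0 < symW t a) :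
    ∃ g ∈ syms, pw (t.find (a.map g)) = symW t a := by
  unfold symW at h ⊢
  by_cases hne : (orbitW t a).Nonempty
  · rw [dif_pos hne] at h ⊢
    have hm := Finset.min'_mem (orbitW t a) hne
    unfold orbitW at hm
    obtain ⟨hm1, -⟩ := Finset.mem_filter.1 hm
    obtain ⟨b, hb, hbw⟩ := Finset.mem_image.1 hm1
    obtain ⟨g, hg, rfl⟩ := mem_images'.1 (List.mem_toFinset.1 hb)
    exact ⟨g, hg, by unfold orbitW; exact hbw⟩
  · rw [dif_neg hne] at h
    exact absurd h (lt_irrefl 0)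

/-- The symmetric weight of the initial state is its tabulated weight (when positive). [cite: PonitzTittmann2000, §3] -/
theorem symW_nil {t : WTrie} (h : 0 < pw (t.find [])) : symW t [] = pw (t.find []) := by
  have hrot : rot 0 ∈ syms := by simp [syms]
  have hmem : pw (t.find (([] : List Step).map (rot 0))) ∈ orbitW t [] := mem_orbitW hrot (by simpa using h)
  refine le_antisymm (by simpa using symW_le hmem) ?_
  obtain ⟨g, -, hg⟩ := exists_map_eq_symW (symW_pos hmem)
  rw [List.map_nil] at hg
  exact hg.le

/-! ### Soundness -/

/-- **Soundness of `verifyTS`**: a successful reduced check yields a Collatz–Wielandt certificate for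
`ptStep K` on the set of states with positive symmetric weight, with weight function `symW t` and
`symW t [] ≤ 2⁴¹`. The inequalities are checked at one tabulated representative per orbit and transported
by the equivariance `ptStep_map`. [cite: PonitzTittmann2000, §3] -/
theorem certificate_of_verifyTS {K N D : ℕ} {t : WTrie} (h : verifyTS K N D t = true) :
    WordAutomaton.Certificate (ptStep K) {a | 1 ≤ symW t a} (symW t) N D ∧ symW t [] ≤ 2 ^ 41 := by
  simp only [verifyTS, Bool.and_eq_true, decide_eq_true_eq] at h
  obtain ⟨⟨h0, hroot⟩, hnodes⟩ := h
  -- the check of a tabulated representative, unpacked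
  have key : ∀ a₁ : List Step, 1 ≤ pw (t.find a₁) →
      (∀ d b, ptStep K a₁ d = some b → 1 ≤ pw (t.find (b.map (symOf (pg (t.find a₁) d))))) ∧
      D * ∑ d : Step, ((ptStep K a₁ d).map fun b => pw (t.find (b.map (symOf (pg (t.find a₁) d))))).getD 0
        ≤ N * pw (t.find a₁) := by
    intro a₁ ha
    have hs : verifyStateS K N D t a₁ = true := by
      have := verifyStateS_of_verifyNodesS t [] a₁ hnodes ha
      simpa using this
    simp only [verifyStateS, Bool.and_eq_true, decide_eq_true_eq, List.all_eq_true] at hs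
    obtain ⟨⟨-, hsucc⟩, hcw⟩ := hs
    refine ⟨fun d b hb => ?_, ?_⟩
    · have := hsucc d (List.mem_finRange d)
      rw [hb] at this
      simpa using this
    · have e : ((List.finRange 4).map fun d =>
          ((ptStep K a₁ d).map fun b => pw (t.find (b.map (symOf (pg (t.find a₁) d))))).getD 0).sum =
          ∑ d : Step, ((ptStep K a₁ d).map fun b => pw (t.find (b.map (symOf (pg (t.find a₁) d))))).getD 0 := by
        rw [← List.sum_ofFn, List.ofFn_eq_map]
      rw [← e]
      exact hcw
  -- a recorded image of a successor, composed with the orbit symmetry, is again an image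
  have compose : ∀ {h : Step → Step}, h ∈ syms → ∀ (i : ℕ) (b : List Step),
      ∃ k ∈ syms, (b.map h).map (symOf i) = b.map k := by
    intro h hh i b
    obtain ⟨k, hk, hkd⟩ := syms_comp' h hh (symOf i) (symOf_mem_syms i)
    exact ⟨k, hk, by rw [List.map_map]; exact List.map_congr_left fun d _ => (hkd d).symm⟩
  have hnil : symW t [] = pw (t.find []) := symW_nil h0
  refine ⟨⟨?_, ?_, ?_, ?_⟩, by rw [hnil]; exact hroot⟩
  · show 1 ≤ symW t []
    rw [hnil]; exact h0
  · -- closure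
    rintro a (ha : 1 ≤ symW t a) d b hb
    obtain ⟨g, hg, hga⟩ := exists_map_eq_symW ha
    have ha₁ : 1 ≤ pw (t.find (a.map g)) := by rw [hga]; exact ha
    have hstep : ptStep K (a.map g) (g d) = some (b.map g) := by
      rw [ptStep_map hg, hb, Option.map_some]
    have h1 := (key _ ha₁).1 (g d) (b.map g) hstep
    obtain ⟨k, hk, hkb⟩ := compose hg (pg (t.find (a.map g)) (g d)) b
    rw [hkb] at h1
    show 1 ≤ symW t b
    exact symW_pos (mem_orbitW hk h1)
  · intro a ha
    exact ha
  · -- the Collatz–Wielandt inequality, transported along the orbit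
    rintro a (ha : 1 ≤ symW t a)
    obtain ⟨g, hg, hga⟩ := exists_map_eq_symW ha
    have ha₁ : 1 ≤ pw (t.find (a.map g)) := by rw [hga]; exact ha
    obtain ⟨g', hg', hinv1, hinv2⟩ := syms_inv' g hg
    set a₁ := a.map g with ha₁_def
    let G : Step → ℕ := fun d' =>
      ((ptStep K a₁ d').map fun b => pw (t.find (b.map (symOf (pg (t.find a₁) d'))))).getD 0
    have hcw : D * ∑ d', G d' ≤ N * pw (t.find a₁) := (key a₁ ha₁).2
    have hterm : ∀ d : Step, ((ptStep K a d).map (symW t)).getD 0 ≤ G (g d) := by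
      intro d
      show _ ≤ ((ptStep K a₁ (g d)).map _).getD 0
      rw [ha₁_def, ptStep_map hg]
      cases hb : ptStep K a d with
      | none => simp
      | some b =>
        simp only [Option.map_some, Option.getD_some]
        have h1 := (key a₁ ha₁).1 (g d) (b.map g) (by rw [ha₁_def, ptStep_map hg, hb, Option.map_some])
        obtain ⟨k, hk, hkb⟩ := compose hg (pg (t.find a₁) (g d)) b
        rw [ha₁_def] at hkb
        rw [hkb] at h1 ⊢
        exact symW_le (mem_orbitW hk h1)
    have hsum : ∑ d : Step, ((ptStep K a d).map (symW t)).getD 0 ≤ ∑ d', G d' := by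
      calc ∑ d : Step, ((ptStep K a d).map (symW t)).getD 0 ≤ ∑ d : Step, G (g d) :=
            Finset.sum_le_sum fun d _ => hterm d
        _ = ∑ d', G d' := Equiv.sum_comp ⟨g, g', hinv1, hinv2⟩ G
    calc D * ∑ d : Step, ((ptStep K a d).map (symW t)).getD 0 ≤ D * ∑ d', G d' :=
          Nat.mul_le_mul_left _ hsum
      _ ≤ N * pw (t.find a₁) := hcw
      _ = N * symW t a := by rw [hga]

/-- **`cₙ · Dⁿ ≤ Nⁿ · 2⁴¹`** from a successful reduced trie certificate check. [cite: PonitzTittmann2000, §3] -/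
theorem count_mul_pow_le_of_verifyTS {K N D : ℕ} {t : WTrie} (h : verifyTS K N D t = true) (n : ℕ) :
    count n * D ^ n ≤ N ^ n * 2 ^ 41 := by
  obtain ⟨hc, hroot⟩ := certificate_of_verifyTS h
  exact le_trans (WordAutomaton.count_mul_pow_le hc (run_ne_none_of_isSAW K) n)
    (Nat.mul_le_mul_left _ hroot)

/-- **`μ(ℤ²) ≤ N/D` from a successful reduced trie certificate check (kernel).**
[cite: PonitzTittmann2000, §3 and Table 2] -/
theorem connectiveConstant_le_of_verifyTS {K N D : ℕ} {t : WTrie} (h : verifyTS K N D t = true)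
    (hD : 0 < D) : connectiveConstant ≤ (N : ℝ) / D :=
  connectiveConstant_le_of_count_bound (count_mul_pow_le_of_verifyTS h) hD

end FiniteMemory

end Literature.Probability.RandomPlanarGeometry.SAW
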